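import Literature.RepresentationTheory.FiniteGroups.InterchangeSpectralGap
import HarnessLib

/-!
# The exclusion process (any number of particles, any number of colours) has at least the random-walk gap

Topic `Literature/RepresentationTheory/FiniteGroups`; companion of `InterchangeSpectralGap.lean` (Caputo–Liggett–Richthammer,
*Proof of Aldous' spectral gap conjecture*, J. Amer. Math. Soc. 23 (2010), Theorem 1.1, in Dirichlet-form language on `𝔖ₙ`:
`clr_spectralGap`).  CLR §1 note that the theorem for the interchange process implies the same lower bound for every process
obtained from it by PROJECTION — in particular the symmetric exclusion process with `k` particles and, more generally, the
coloured exclusion (multi-species stirring) process: declare the labels of a reference colouring `σ₁ : Fin n → κ` indistinguishable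
within each colour class; a function of the colouring is a function on `𝔖ₙ` constant on the fibres of `τ ↦ σ₁ ∘ τ⁻¹`.

* `clr_exclusion_spectralGap` — for non-negative rates `A` and every `ψ : (Fin n → κ) → ℂ` supported on the `𝔖ₙ`-orbit
  `{σ₁ ∘ π}` of a colouring `σ₁` and with `Σ_σ ψ σ = 0`:
  `λ₁^{RW}(A) · Σ_σ ‖ψ σ‖² ≤ Σ_{x<y} a_{xy} · ½ Σ_σ ‖ψ(σ ∘ (x y)) − ψ(σ)‖²`
  (`λ₁^{RW}` the random-walk gap of `InterchangeSpectralGap.lean`, written out).  Proof: lift `f(τ) = ψ(σ₁ ∘ τ⁻¹)`; left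
  multiplication by `π⁻¹` on `𝔖ₙ` acts as `σ ↦ σ ∘ π` on colourings, so the fibres of the lift over the orbit all have the
  cardinality of the stabiliser and mean, `ℓ²`-norm and Dirichlet form of `f` are that constant times those of `ψ`;
  apply `clr_spectralGap`.
* `exclusion_poincare_of_rayleigh` — the same with an explicit constant `t` below every mean-zero random-walk Rayleigh quotient
  (`le_gapRW`, `n ≥ 2`).

Not here: the identification of these Dirichlet forms with generators of specific spin models (done summit-side, e.g.
`Summit.HubbardSuperconductivity.…AnisotropyChord.Transfer.exclusion_poincare_of_rw_gap` for the `Δ = 1` XXZ chain).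

## References

* P. Caputo, T. M. Liggett, T. Richthammer, *Proof of Aldous' spectral gap conjecture*, J. Amer. Math. Soc. 23 (2010)
  831–851, arXiv:0906.1238: Theorem 1.1 and §1 (consequences for exclusion-type processes). [CaputoLiggettRichthammer2010]
* T. M. Liggett, *Interacting Particle Systems*, Springer (1985), Ch. VIII (exclusion and stirring). [Liggett1985]
-/

noncomputable section

open scoped BigOperators
open Equiv Finset

namespace Literature.RepresentationTheory.FiniteGroups

section Exclusion

variable {n : ℕ} {κ : Type*} [Fintype κ] [DecidableEq κ]

/-- **Caputo–Liggett–Richthammer for (coloured) exclusion processes.**  For non-negative rates `A` on `Fin n`, a reference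
colouring `σ₁ : Fin n → κ` and every `ψ : (Fin n → κ) → ℂ` supported on the orbit `{σ₁ ∘ π : π ∈ 𝔖ₙ}` with `Σ_σ ψ σ = 0`:
`λ₁^{RW}(A) · Σ_σ ‖ψ σ‖² ≤ Σ_{x<y} a_{xy} · ½ Σ_σ ‖ψ(σ ∘ (x y)) − ψ σ‖²` — the exclusion / multi-species stirring process
generated by the transpositions of sites at rates `a_{xy}` has, on every orbit (particle-number sector), spectral gap at least the
random-walk gap.  (Projection of Theorem 1.1: lift `ψ` to `f(τ) = ψ(σ₁ ∘ τ⁻¹)` on `𝔖ₙ`, whose fibres over the orbit have constant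
size.) [cite: CaputoLiggettRichthammer2010, Theorem 1.1] -/
theorem clr_exclusion_spectralGap (A : Fin n → Fin n → ℝ) (hA : ∀ x y, 0 ≤ A x y)
    (σ₁ : Fin n → κ) (ψ : (Fin n → κ) → ℂ)
    (hsupp : ∀ σ, ψ σ ≠ 0 → ∃ π : Perm (Fin n), σ = σ₁ ∘ ⇑π) (hmean : ∑ σ, ψ σ = 0) :
    sInf ((fun φ : Fin n → ℂ => (∑ x : Fin n, ∑ y : Fin n with x < y, A x y * ‖φ x - φ y‖ ^ 2) / l2NormSq φ) ''
        {φ : Fin n → ℂ | ∑ x, φ x = 0 ∧ φ ≠ 0}) * ∑ σ, ‖ψ σ‖ ^ 2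
      ≤ ∑ x : Fin n, ∑ y : Fin n with x < y, A x y * ((∑ σ, ‖ψ (σ ∘ ⇑(swap x y)) - ψ σ‖ ^ 2) / 2) := by
  classical
  -- the lift of colourings to permutations
  let occ : Perm (Fin n) → (Fin n → κ) := fun τ => σ₁ ∘ ⇑τ⁻¹
  have hocc_one : occ 1 = σ₁ := by
    funext v
    show σ₁ ((1 : Perm (Fin n))⁻¹ v) = σ₁ v
    rw [inv_one, Perm.one_apply]
  have hocc_mul : ∀ π τ : Perm (Fin n), occ (π⁻¹ * τ) = occ τ ∘ ⇑π := by
    intro π τ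
    funext v
    simp only [occ, Function.comp_apply, mul_inv_rev, inv_inv, Perm.coe_mul]
  have hocc_swap : ∀ (x y : Fin n) (τ : Perm (Fin n)), occ (swap x y * τ) = occ τ ∘ ⇑(swap x y) := by
    intro x y τ
    rw [← hocc_mul, swap_inv]
  -- fibre multiplicities
  let m : (Fin n → κ) → ℕ := fun σ => (univ.filter fun τ : Perm (Fin n) => occ τ = σ).card
  have hsum : ∀ {β : Type} [AddCommMonoid β] (F : (Fin n → κ) → β), ∑ τ, F (occ τ) = ∑ σ, m σ • F σ := by
    intro β _ F
    rw [← sum_fiberwise_of_maps_to (s := univ) (t := univ) (g := occ) (fun τ _ => mem_univ _) (fun τ => F (occ τ))]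
    refine sum_congr rfl fun σ _ => ?_
    rw [sum_congr rfl (fun τ hτ => by rw [(mem_filter.mp hτ).2] :
      ∀ τ ∈ univ.filter (fun τ => occ τ = σ), F (occ τ) = F σ), sum_const]
  -- the multiplicity is invariant along the orbit
  have hm_orbit : ∀ (π : Perm (Fin n)) (σ : Fin n → κ), m (σ ∘ ⇑π) = m σ := by
    intro π σ
    symm
    refine card_equiv (Equiv.mulLeft π⁻¹) fun τ => ?_
    simp only [mem_filter, mem_univ, true_and, Equiv.coe_mulLeft]
    rw [hocc_mul]
    constructor
    · intro h
      rw [h]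
    · intro h
      funext v
      have hv := congrFun h (π.symm v)
      simpa using hv
  set c : ℕ := m σ₁ with hc
  have hc_pos : 0 < c := by
    have h1 : (1 : Perm (Fin n)) ∈ univ.filter (fun τ : Perm (Fin n) => occ τ = σ₁) := by
      simp [hocc_one]
    exact card_pos.mpr ⟨1, h1⟩
  -- sums of orbit-supported functions along the lift
  have hsumS : ∀ {β : Type} [AddCommMonoid β] (F : (Fin n → κ) → β),
      (∀ σ, F σ ≠ 0 → ∃ π : Perm (Fin n), σ = σ₁ ∘ ⇑π) → ∑ τ, F (occ τ) = c • ∑ σ, F σ := by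
    intro β _ F hF
    rw [hsum, smul_sum]
    refine sum_congr rfl fun σ _ => ?_
    by_cases h0 : F σ = 0
    · rw [h0, smul_zero, smul_zero]
    · obtain ⟨π, rfl⟩ := hF σ h0
      rw [hm_orbit]
  -- support of the three integrands
  have hψoff : ∀ σ, (¬ ∃ π : Perm (Fin n), σ = σ₁ ∘ ⇑π) → ψ σ = 0 := fun σ hσ => by
    by_contra h
    exact hσ (hsupp σ h)
  have hsupp_sq : ∀ σ, ‖ψ σ‖ ^ 2 ≠ 0 → ∃ π : Perm (Fin n), σ = σ₁ ∘ ⇑π := fun σ h =>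
    hsupp σ (by intro h0; exact h (by rw [h0, norm_zero]; ring))
  have hsupp_diff : ∀ (x y : Fin n) (σ : Fin n → κ), ‖ψ (σ ∘ ⇑(swap x y)) - ψ σ‖ ^ 2 ≠ 0 →
      ∃ π : Perm (Fin n), σ = σ₁ ∘ ⇑π := by
    intro x y σ h
    by_cases h1 : ψ σ ≠ 0
    · exact hsupp σ h1
    · push Not at h1
      have h2 : ψ (σ ∘ ⇑(swap x y)) ≠ 0 := by
        intro h0
        exact h (by rw [h0, h1, sub_zero, norm_zero]; ring)
      obtain ⟨π, hπ⟩ := hsupp _ h2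
      refine ⟨π * swap x y, ?_⟩
      have : σ = (σ ∘ ⇑(swap x y)) ∘ ⇑(swap x y) := by
        funext v
        simp [Function.comp_apply, swap_apply_self]
      rw [this, hπ]
      funext v
      simp only [Function.comp_apply, Perm.coe_mul]
  -- the lift `f` and its mean, norm and Dirichlet form
  let f : Perm (Fin n) → ℂ := fun τ => ψ (occ τ)
  have hf_mean : ∑ τ, f τ = 0 := by
    simp only [f]
    rw [hsumS ψ hsupp, hmean, smul_zero]
  have hf_norm : l2NormSq f = (c : ℝ) * ∑ σ, ‖ψ σ‖ ^ 2 := by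
    simp only [l2NormSq, f]
    rw [hsumS (fun σ => ‖ψ σ‖ ^ 2) hsupp_sq, nsmul_eq_mul]
  have hf_dir : ∀ x y : Fin n, transpDirichlet x y f = (c : ℝ) * ∑ σ, ‖ψ (σ ∘ ⇑(swap x y)) - ψ σ‖ ^ 2 := by
    intro x y
    simp only [transpDirichlet, f]
    simp_rw [hocc_swap]
    rw [hsumS (fun σ => ‖ψ (σ ∘ ⇑(swap x y)) - ψ σ‖ ^ 2) (hsupp_diff x y), nsmul_eq_mul]
  -- CLR for the lift
  have hclr := clr_spectralGap n A hA f hf_mean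
  rw [hf_norm] at hclr
  simp_rw [hf_dir] at hclr
  have hcR : (0 : ℝ) < c := by exact_mod_cast hc_pos
  -- divide by the fibre size
  have hrhs : (∑ x : Fin n, ∑ y : Fin n with x < y, A x y * ((c : ℝ) * (∑ σ, ‖ψ (σ ∘ ⇑(swap x y)) - ψ σ‖ ^ 2) / 2))
      = (c : ℝ) * ∑ x : Fin n, ∑ y : Fin n with x < y, A x y * ((∑ σ, ‖ψ (σ ∘ ⇑(swap x y)) - ψ σ‖ ^ 2) / 2) := by
    rw [mul_sum]
    refine sum_congr rfl fun x _ => ?_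
    rw [mul_sum]
    refine sum_congr rfl fun y _ => ?_
    ring
  rw [hrhs, ← mul_assoc, mul_comm _ (c : ℝ), mul_assoc] at hclr
  exact le_of_mul_le_mul_left hclr hcR

/-- **Exclusion Poincaré inequality with an explicit constant:** if `t` is below every mean-zero random-walk Rayleigh quotient
of the rates `A` on `Fin n` (`n ≥ 2`), then for every `ψ` supported on an `𝔖ₙ`-orbit of colourings with `Σ ψ = 0`,
`t · Σ_σ ‖ψ σ‖² ≤ Σ_{x<y} a_{xy} · ½ Σ_σ ‖ψ(σ ∘ (x y)) − ψ σ‖²`. [cite: CaputoLiggettRichthammer2010, Theorem 1.1] -/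
theorem exclusion_poincare_of_rayleigh (hn : 2 ≤ n) (A : Fin n → Fin n → ℝ) (hA : ∀ x y, 0 ≤ A x y) {t : ℝ}
    (ht : ∀ φ : Fin n → ℂ, ∑ x, φ x = 0 → φ ≠ 0 →
      t ≤ (∑ x : Fin n, ∑ y : Fin n with x < y, A x y * ‖φ x - φ y‖ ^ 2) / l2NormSq φ)
    (σ₁ : Fin n → κ) (ψ : (Fin n → κ) → ℂ)
    (hsupp : ∀ σ, ψ σ ≠ 0 → ∃ π : Perm (Fin n), σ = σ₁ ∘ ⇑π) (hmean : ∑ σ, ψ σ = 0) :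
    t * ∑ σ, ‖ψ σ‖ ^ 2
      ≤ ∑ x : Fin n, ∑ y : Fin n with x < y, A x y * ((∑ σ, ‖ψ (σ ∘ ⇑(swap x y)) - ψ σ‖ ^ 2) / 2) := by
  have hgap := le_gapRW hn ht
  have hclr := clr_exclusion_spectralGap A hA σ₁ ψ hsupp hmean
  exact le_trans (mul_le_mul_of_nonneg_right hgap (sum_nonneg fun σ _ => sq_nonneg _)) hclr

end Exclusion

end Literature.RepresentationTheory.FiniteGroups

end
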